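import Mathlib
import HarnessLib
import Summits.HubbardSuperconductivity.HubbardSuperconductivity.Theorems.KLProgrammeKLRegimeEngineLadderExact

/-!
# Route `KLProgramme` — crux K3, ENGINE child `KLRegimeEngineV11` (stmt-HubbardSuperconductivity-19823) and its gen-4 successor:
# the (E2) pair-ladder step with SIGNED slice weights — ONE constructor for every Δ21 repair text on the table

Cell gate-hubbard-kl, seat hubbard-kl-k3c1-p1 (g3; technique «composed-map remainder propagation»); sequel to p466393 `…EngineLadderExact`.

Δ21 (CONFIRMED, plan g10 STATUS l.1176/l.1197; decider HOME/hubbard-kl-k3c1-p1/DELTA21-PHI.md): the true slice-`n` pair weights at an edge-zone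
pair-class momentum carry an `n`-independent negative-mass fraction, so the `1 ≤ n` conjunct of (E2-v7) `PairLadderStepAtV7` (model weights
`w ≥ 0`) is not certifiable there.  Three repair texts are on the table for the gen-4 bundle, all quantifying over SIGNED weights and differing
only in the MASS conjunct next to `Σ‖w‖ ≤ bhi`:
* NET form (plan g10 l.1197 / plan g11 `PairLadderStepAtV8Rw2`): `w : _ → ℂ`, `-E(Qm) ≤ Re Σ w`;
* SIGNED-MASS form (p1 g7 STATUS l.1238): `w : _ → ℂ`, `(Σ‖w‖) − Re Σ w ≤ E(Qm)`;
* REAL three-conjunct form (k3c1-p2 g2 STATUS l.1233, what row 0′'s cascade reads): `w : _ → ℝ`, `Σ(|w| − w) ≤ E(Qm)` (and `-E(Qm) ≤ Σ w`,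
  implied),
each followed by `∃ N, (1 + diag w·𝒞_{n−1}(Qm))·N = 1 ∧` the V7 remainder budget verbatim; `E(Qm)` is an edge profile (`klEdge`, `edgeBar`,
`2·bhi·negEdgeBar …`) whose name and numerals are still being typed.

This file is the BRIDGE from expansion-level data to all three at once, with the allowance `E : TorusSite 2 L → ℝ` and the remainder budget
`B` ABSTRACT (pure pass-through), so that the by-name instance on the gen-4 clause is a projection whichever text lands:
§1 signed-mass bookkeeping — `0 ≤ (Σ‖w‖) − Re Σ w ≤ 2·Σ‖w‖`, the net form from the signed form, the signed mass vanishes on pointwise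
nonnegative real weights and in general is `≤ 2·(mass of the exceptional weights)` (`klpls_signedMass_le_of_pointwise`), real recasting;
§2 **`klpls_signedStep`** (one pair class, pure linear algebra over `klell_localised_ladder_rightInverse`): from `|C| ≤ m`, the rung array `K` on
`S × F` (`|K| ≤ m′`), frequency-resolved weights `z′` (`m·Σ‖z′‖ ≤ 1/3`, `m′·Σ‖z′‖ ≤ 1/3`, `Σ‖z′‖ ≤ b`), the `K`-ladder sum and the AGGREGATED signed-mass
input `(Σ_s ‖Σ_b z′_(s,b)‖) − Re Σ_s Σ_b z′_(s,b) ≤ E`: the weights `w_s := Σ_b z′_(s,b)` satisfy all three mass conjuncts, `1 + diag w·C` has a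
two-sided inverse `N`, and `|T_K(x,y) − (C N)(x.1,y.1)|` is within the four-term localisation expression — NO transfer term (w IS the true
aggregated weight); `klpls_signedStepReal` (extra input `Im Σ_b z′_(s,b) = 0`, true for the slice weights by `ν ↦ −ν`): the same with `w` REAL;
§3 model level: **`klpls_signedStep_of_expansion`** / **`klpls_signedStepReal_of_expansion`** — per pair class `Qm` of scale `n ≥ 1`, from the
split slot `PairArrayAtV2 … (n−1)` (entry bound `2|U| + D·U²`), the smallness `bhi·(2|U| + D·U²) ≤ 1/3` (`klEng_pair_smallness`) and the engine's
expansion data with ONE per-entry accounting `‖𝒞_n − T_K‖ + [four-term localisation] ≤ B Qm k k′` on the ball: the `∃ w ∃ N` body with the three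
mass conjuncts, both inverse identities and `‖𝒞_n(Qm;k,k′) − (𝒞_{n−1}(Qm)·N)(k,k′)‖ ≤ B Qm k k′`; `klpls_signedStep_of_expansion_V7budget`: `B :=`
the V7 budget verbatim.  How the engine meets the mass input: deep inside the class by pointwise positivity of the aggregated weights
(`klpls_signedMass_le_of_pointwise` with no exceptional weights ⇒ `0 ≤ E`), at the edge by `≤ 2·Σ‖w‖ ≤ 2·bhi` (so the profile must reach `2·bhi`
there), or by the `Q`-Lipschitz route `klpli_norm_sum_sub_re_sum_le` (p466393).
Everything is proved; no definitions; nothing about the model is asserted beyond these implications.  0 kit.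
-/

noncomputable section

namespace Summit.HubbardSuperconductivity.HubbardSuperconductivity.Theorems.KLRegimeSplit

set_option linter.dupNamespace false -- summit = problem name (single-conjunct summit), D-0017

open Finset Matrix Literature.MathematicalPhysics.QuantumLattice Literature.Probability.LatticeModels
open Summit.HubbardSuperconductivity.HubbardSuperconductivity.Theorems.KLProgrammeCooperResummation

/-! ## §1 Signed-mass bookkeeping -/

section Mass

variable {S : Type*} [Fintype S]

/-- `Re Σ w ≤ Σ‖w‖`. -/
theorem klpls_re_sum_le_sum_norm (w : S → ℂ) : (∑ s, w s).re ≤ ∑ s, ‖w s‖ :=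
  (Complex.re_le_norm _).trans (norm_sum_le _ _)

/-- The signed mass is nonnegative: `0 ≤ (Σ‖w‖) − Re Σ w`. -/
theorem klpls_signedMass_nonneg (w : S → ℂ) : 0 ≤ (∑ s, ‖w s‖) - (∑ s, w s).re :=
  sub_nonneg.mpr (klpls_re_sum_le_sum_norm w)

/-- The signed mass is at most twice the total variation: `(Σ‖w‖) − Re Σ w ≤ 2·Σ‖w‖`. -/
theorem klpls_signedMass_le_two_mul (w : S → ℂ) : (∑ s, ‖w s‖) - (∑ s, w s).re ≤ 2 * ∑ s, ‖w s‖ := by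
  have h1 : -(∑ s, w s).re ≤ ∑ s, ‖w s‖ := by
    have h := klpls_re_sum_le_sum_norm fun s => -w s
    simp only [sum_neg_distrib, Complex.neg_re, norm_neg] at h
    exact h
  linarith

/-- **Net form from signed form**: `(Σ‖w‖) − Re Σ w ≤ E ⟹ -E ≤ Re Σ w`. -/
theorem klpls_neg_le_re_sum_of_signedMass_le (w : S → ℂ) {E : ℝ} (h : (∑ s, ‖w s‖) - (∑ s, w s).re ≤ E) :
    -E ≤ (∑ s, w s).re := by
  have := sum_nonneg fun s (_ : s ∈ (univ : Finset S)) => norm_nonneg (w s)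
  linarith

/-- **Signed mass against pointwise positivity with exceptions.**  If every weight outside the exceptional set `A` is a nonnegative real, then
`(Σ‖w‖) − Re Σ w ≤ 2·Σ_{s ∈ A} ‖w_s‖`. -/
theorem klpls_signedMass_le_of_pointwise [DecidableEq S] (w : S → ℂ) (A : Finset S)
    (h : ∀ s, s ∉ A → 0 ≤ (w s).re ∧ (w s).im = 0) :
    (∑ s, ‖w s‖) - (∑ s, w s).re ≤ 2 * ∑ s ∈ A, ‖w s‖ := by
  classical
  rw [Complex.re_sum, ← sum_sub_distrib]
  have key : ∀ s, ‖w s‖ - (w s).re ≤ if s ∈ A then 2 * ‖w s‖ else 0 := by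
    intro s
    split_ifs with hs
    · have := Complex.re_le_norm (-w s)
      rw [norm_neg, Complex.neg_re] at this
      linarith
    · obtain ⟨hre, him⟩ := h s hs
      have : ‖w s‖ = (w s).re := by
        rw [← Complex.re_add_im (w s), him]
        simp [abs_of_nonneg hre]
      linarith
  calc ∑ s, (‖w s‖ - (w s).re) ≤ ∑ s, (if s ∈ A then 2 * ‖w s‖ else 0) := sum_le_sum fun s _ => key s
    _ = 2 * ∑ s ∈ A, ‖w s‖ := by rw [← sum_filter, filter_mem_eq_inter, univ_inter, mul_sum]

/-- Pointwise nonnegative real weights have signed mass `0`. -/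
theorem klpls_signedMass_eq_zero_of_pointwise (w : S → ℂ) (h : ∀ s, 0 ≤ (w s).re ∧ (w s).im = 0) :
    (∑ s, ‖w s‖) - (∑ s, w s).re = 0 := by
  classical
  refine le_antisymm ?_ (klpls_signedMass_nonneg w)
  have := klpls_signedMass_le_of_pointwise w ∅ fun s _ => h s
  simpa using this

/-- **Real recasting.**  If `Im w_s = 0` for all `s`, the real parts `v_s := Re w_s` cast back to `w`, `|v_s| = ‖w_s‖`, and the real negative-mass
functional is the signed mass: `Σ(|v| − v) = (Σ‖w‖) − Re Σ w`. -/
theorem klpls_real_recast (w : S → ℂ) (h : ∀ s, (w s).im = 0) :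
    (fun s => (((w s).re : ℝ) : ℂ)) = w ∧ (∀ s, |(w s).re| = ‖w s‖) ∧
      ∑ s, (|(w s).re| - (w s).re) = (∑ s, ‖w s‖) - (∑ s, w s).re := by
  have hcast : ∀ s, (((w s).re : ℝ) : ℂ) = w s := fun s => Complex.ext (by simp) (by simp [h s])
  have habs : ∀ s, |(w s).re| = ‖w s‖ := fun s => by
    rw [← Real.norm_eq_abs, ← Complex.norm_real, hcast s]
  refine ⟨funext hcast, habs, ?_⟩
  rw [sum_sub_distrib, Complex.re_sum]
  exact congrArg₂ (· - ·) (sum_congr rfl fun s _ => habs s) rfl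

end Mass

/-! ## §2 One pair class: the exact aggregated ladder with signed weights -/

section Step

variable {S F : Type*} [Fintype S] [DecidableEq S] [Nonempty S] [Fintype F] [DecidableEq F] [Nonempty F]

/-- **The signed step, one pair class (complex weights).**  `C` on `S` with `|C| ≤ m`; rung array `K` on `S × F` with `|K| ≤ m′`; frequency-resolved
weights `z′` with `m·Σ‖z′‖ ≤ 1/3`, `m′·Σ‖z′‖ ≤ 1/3`, `Σ‖z′‖ ≤ b`; the aggregated signed-mass input `(Σ_s ‖Σ_b z′_(s,b)‖) − Re Σ_s Σ_b z′_(s,b) ≤ E`;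
`T_K` the `K`-ladder sum.  Then the aggregated weights `w_s := Σ_b z′_(s,b)` have `Σ‖w‖ ≤ b`, `(Σ‖w‖) − Re Σ w ≤ E`, `-E ≤ Re Σ w`; `1 + diag w·C` has a
two-sided inverse `N`; and `|T_K(x,y) − (C N)(x.1,y.1)|` is within the four-term localisation expression (`E(x,y) = K(x,y) − C(x.1,y.1)`). -/
theorem klpls_signedStep (C : Matrix S S ℂ) (K : Matrix (S × F) (S × F) ℂ) (z' : S × F → ℂ) {m m' b E : ℝ}
    (hm : 0 ≤ m) (hm' : 0 ≤ m') (hC : ∀ s t, ‖C s t‖ ≤ m) (hK : ∀ x y, ‖K x y‖ ≤ m')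
    (hzC : m * ∑ x, ‖z' x‖ ≤ 1 / 3) (hzK : m' * ∑ x, ‖z' x‖ ≤ 1 / 3) (hzb : ∑ x, ‖z' x‖ ≤ b)
    (hmass : (∑ s, ‖∑ b, z' (s, b)‖) - (∑ s, ∑ b, z' (s, b)).re ≤ E)
    (TK : Matrix (S × F) (S × F) ℂ) (hTK : HasSum (fun j : ℕ => K * (-(Matrix.diagonal z' * K)) ^ j) TK) :
    ∃ w : S → ℂ, w = (fun s => ∑ b, z' (s, b)) ∧ (∑ s, ‖w s‖ ≤ b) ∧ ((∑ s, ‖w s‖) - (∑ s, w s).re ≤ E) ∧ (-E ≤ (∑ s, w s).re) ∧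
      ∃ N : Matrix S S ℂ, (1 + Matrix.diagonal w * C) * N = 1 ∧ N * (1 + Matrix.diagonal w * C) = 1 ∧
        (∀ s t, ‖(C * N) s t‖ ≤ 3 / 2 * m) ∧
        ∀ x y : S × F,
          ‖TK x y - (C * N) x.1 y.1‖ ≤ ‖K x y - C x.1 y.1‖ +
            3 / 2 * m * ∑ b, ‖K x b - C x.1 b.1‖ * ‖z' b‖ +
            3 / 2 * m' * ∑ a, ‖z' a‖ * ‖K a y - C a.1 y.1‖ +
            9 / 4 * m' * m * ∑ a, ∑ b, ‖z' a‖ * ‖K a b - C a.1 b.1‖ * ‖z' b‖ := by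
  obtain ⟨N, hN1, hN2, hCN, -, hbd⟩ := klell_localised_ladder_rightInverse C K z' hm hm' hC hK hzC hzK TK hTK
  exact ⟨fun s => ∑ b, z' (s, b), rfl, (klell_sum_norm_aggregate_le z').trans hzb, hmass,
    klpls_neg_le_re_sum_of_signedMass_le _ hmass, N, hN1, hN2, hCN, hbd⟩

/-- **The signed step, one pair class, REAL weights.**  As `klpls_signedStep`, with the extra input `Im Σ_b z′_(s,b) = 0` for every `s`: the weights
`w_s := Re Σ_b z′_(s,b)` are real, cast back to the aggregated weights, and satisfy `Σ|w| ≤ b`, `Σ(|w| − w) ≤ E`, `-E ≤ Σ w`. -/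
theorem klpls_signedStepReal (C : Matrix S S ℂ) (K : Matrix (S × F) (S × F) ℂ) (z' : S × F → ℂ) {m m' b E : ℝ}
    (hm : 0 ≤ m) (hm' : 0 ≤ m') (hC : ∀ s t, ‖C s t‖ ≤ m) (hK : ∀ x y, ‖K x y‖ ≤ m')
    (hzC : m * ∑ x, ‖z' x‖ ≤ 1 / 3) (hzK : m' * ∑ x, ‖z' x‖ ≤ 1 / 3) (hzb : ∑ x, ‖z' x‖ ≤ b)
    (hmass : (∑ s, ‖∑ b, z' (s, b)‖) - (∑ s, ∑ b, z' (s, b)).re ≤ E) (hreal : ∀ s, (∑ b, z' (s, b)).im = 0)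
    (TK : Matrix (S × F) (S × F) ℂ) (hTK : HasSum (fun j : ℕ => K * (-(Matrix.diagonal z' * K)) ^ j) TK) :
    ∃ w : S → ℝ, (fun s => (w s : ℂ)) = (fun s => ∑ b, z' (s, b)) ∧
      (∑ s, |w s| ≤ b) ∧ (∑ s, (|w s| - w s) ≤ E) ∧ (-E ≤ ∑ s, w s) ∧
      ∃ N : Matrix S S ℂ, (1 + Matrix.diagonal (fun s => (w s : ℂ)) * C) * N = 1 ∧ N * (1 + Matrix.diagonal (fun s => (w s : ℂ)) * C) = 1 ∧
        (∀ s t, ‖(C * N) s t‖ ≤ 3 / 2 * m) ∧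
        ∀ x y : S × F,
          ‖TK x y - (C * N) x.1 y.1‖ ≤ ‖K x y - C x.1 y.1‖ +
            3 / 2 * m * ∑ b, ‖K x b - C x.1 b.1‖ * ‖z' b‖ +
            3 / 2 * m' * ∑ a, ‖z' a‖ * ‖K a y - C a.1 y.1‖ +
            9 / 4 * m' * m * ∑ a, ∑ b, ‖z' a‖ * ‖K a b - C a.1 b.1‖ * ‖z' b‖ := by
  obtain ⟨w, hw, hb, hE, -, N, hN1, hN2, hCN, hbd⟩ := klpls_signedStep C K z' hm hm' hC hK hzC hzK hzb hmass TK hTK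
  subst hw
  obtain ⟨hcast, habs, hsum⟩ := klpls_real_recast (fun s => ∑ b, z' (s, b)) hreal
  refine ⟨fun s => (∑ b, z' (s, b)).re, hcast, ?_, ?_, ?_, N, ?_, ?_, hCN, hbd⟩
  · calc ∑ s, |(∑ b, z' (s, b)).re| = ∑ s, ‖∑ b, z' (s, b)‖ := sum_congr rfl fun s _ => habs s
      _ ≤ b := hb
  · rw [hsum]; exact hE
  · have h := klpls_neg_le_re_sum_of_signedMass_le _ hE
    rwa [Complex.re_sum] at h
  · rw [hcast]; exact hN1
  · rw [hcast]; exact hN2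

end Step

/-! ## §3 Model level: the `1 ≤ n` body of the signed (E2) clause from expansion-level data -/

section Model

variable (L M : ℕ) [NeZero L] [NeZero M]
variable {F : Type*} [Fintype F] [DecidableEq F] [Nonempty F]

/-- **The signed (E2) step at `1 ≤ n` from expansion-level data, ABSTRACT allowance `E` and budget `B` (complex weights).**  Fix the slice-frequency
index type `F` and the external index `a₀ : F`.  Inputs: an entry bound `|𝒞_{n−1}(Qm)| ≤ m` for all `Qm` with `bhi·m ≤ 1/3`; per pair class `Qm`
the engine's rung array `K` (`|K| ≤ m′`, `m′·Σ‖z′‖ ≤ 1/3`), frequency-resolved weights `z′` (`Σ‖z′‖ ≤ bhi`), the AGGREGATED signed-mass fact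
`(Σ_p ‖Σ_b z′_(p,b)‖) − Re Σ_p Σ_b z′_(p,b) ≤ E Qm`, the `K`-ladder sum `T_K`, and ONE per-entry accounting on the ball
`‖𝒞_n(Qm)(k,k′) − T_K((k,a₀),(k′,a₀))‖ + [four-term localisation expression at the external entries] ≤ B Qm k k′`.
Output, per pair class: `w :=` the aggregated weights with `Σ‖w‖ ≤ bhi`, `(Σ‖w‖) − Re Σ w ≤ E Qm`, `-E Qm ≤ Re Σ w`, a two-sided inverse `N` of
`1 + diag w·𝒞_{n−1}(Qm)`, and `‖𝒞_n(Qm;k,k′) − (𝒞_{n−1}(Qm)·N)(k,k′)‖ ≤ B Qm k k′` on the ball — every signed (E2) text is a projection of this. -/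
theorem klpls_signedStep_of_expansion {G : GeoConsts} {β U μ : ℝ} {K₀ : TrigPolyC4v} {n : ℕ} (a₀ : F) {m : ℝ}
    (E : TorusSite 2 L → ℝ) (B : TorusSite 2 L → TorusSite 2 L → TorusSite 2 L → ℝ)
    (hm : 0 ≤ m) (hC : ∀ Qm s t, ‖klPairArray L M β U μ K₀ (n - 1) Qm s t‖ ≤ m) (hsmall : G.bhi * m ≤ 1 / 3)
    (hexp : ∀ Qm : TorusSite 2 L, IsPairClassAt L Qm n →
      ∃ (K : Matrix (TorusSite 2 L × F) (TorusSite 2 L × F) ℂ) (z' : TorusSite 2 L × F → ℂ)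
        (TK : Matrix (TorusSite 2 L × F) (TorusSite 2 L × F) ℂ) (m' : ℝ),
        0 ≤ m' ∧ (∀ x y, ‖K x y‖ ≤ m') ∧ m' * ∑ x, ‖z' x‖ ≤ 1 / 3 ∧ ∑ x, ‖z' x‖ ≤ G.bhi ∧
        (∑ p, ‖∑ b, z' (p, b)‖) - (∑ p, ∑ b, z' (p, b)).re ≤ E Qm ∧
        HasSum (fun j : ℕ => K * (-(Matrix.diagonal z' * K)) ^ j) TK ∧
        ∀ k ∈ klBall L μ K₀, ∀ k' ∈ klBall L μ K₀,
          ‖klPairAmplitude L M β U μ K₀ n Qm k k' - TK (k, a₀) (k', a₀)‖ +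
            (‖K (k, a₀) (k', a₀) - klPairArray L M β U μ K₀ (n - 1) Qm k k'‖ +
              3 / 2 * m * ∑ b, ‖K (k, a₀) b - klPairArray L M β U μ K₀ (n - 1) Qm k b.1‖ * ‖z' b‖ +
              3 / 2 * m' * ∑ a, ‖z' a‖ * ‖K a (k', a₀) - klPairArray L M β U μ K₀ (n - 1) Qm a.1 k'‖ +
              9 / 4 * m' * m * ∑ a, ∑ b, ‖z' a‖ * ‖K a b - klPairArray L M β U μ K₀ (n - 1) Qm a.1 b.1‖ * ‖z' b‖) ≤
          B Qm k k') :
    ∀ Qm : TorusSite 2 L, IsPairClassAt L Qm n →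
      ∃ w : TorusSite 2 L → ℂ, (∑ p, ‖w p‖ ≤ G.bhi) ∧ ((∑ p, ‖w p‖) - (∑ p, w p).re ≤ E Qm) ∧ (-E Qm ≤ (∑ p, w p).re) ∧
        ∃ N : Matrix (TorusSite 2 L) (TorusSite 2 L) ℂ,
          (1 + Matrix.diagonal w * klPairArray L M β U μ K₀ (n - 1) Qm) * N = 1 ∧
          N * (1 + Matrix.diagonal w * klPairArray L M β U μ K₀ (n - 1) Qm) = 1 ∧
          ∀ k ∈ klBall L μ K₀, ∀ k' ∈ klBall L μ K₀,
            ‖klPairAmplitude L M β U μ K₀ n Qm k k' - (klPairArray L M β U μ K₀ (n - 1) Qm * N) k k'‖ ≤ B Qm k k' := by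
  intro Qm hQm
  obtain ⟨K, z', TK, m', hm', hK, hzK, hzsum, hmass, hTK, hacc⟩ := hexp Qm hQm
  have hzC : m * ∑ x, ‖z' x‖ ≤ 1 / 3 :=
    calc m * ∑ x, ‖z' x‖ ≤ m * G.bhi := mul_le_mul_of_nonneg_left hzsum hm
      _ = G.bhi * m := mul_comm _ _
      _ ≤ 1 / 3 := hsmall
  obtain ⟨w, hw, hb, hE, hnet, N, hN1, hN2, -, hbd⟩ :=
    klpls_signedStep (klPairArray L M β U μ K₀ (n - 1) Qm) K z' hm hm' (hC Qm) hK hzC hzK hzsum hmass TK hTK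
  refine ⟨w, hb, hE, hnet, N, hN1, hN2, fun k hk k' hk' => ?_⟩
  have h1 := hacc k hk k' hk'
  have h2 := hbd (k, a₀) (k', a₀)
  have h3 := norm_nonneg (klPairAmplitude L M β U μ K₀ n Qm k k' - TK (k, a₀) (k', a₀))
  calc ‖klPairAmplitude L M β U μ K₀ n Qm k k' - (klPairArray L M β U μ K₀ (n - 1) Qm * N) k k'‖
      = ‖(klPairAmplitude L M β U μ K₀ n Qm k k' - TK (k, a₀) (k', a₀)) +
          (TK (k, a₀) (k', a₀) - (klPairArray L M β U μ K₀ (n - 1) Qm * N) k k')‖ := by rw [sub_add_sub_cancel]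
    _ ≤ ‖klPairAmplitude L M β U μ K₀ n Qm k k' - TK (k, a₀) (k', a₀)‖ +
          ‖TK (k, a₀) (k', a₀) - (klPairArray L M β U μ K₀ (n - 1) Qm * N) k k'‖ := norm_add_le _ _
    _ ≤ B Qm k k' := by linarith

/-- **The signed (E2) step at `1 ≤ n`, REAL weights** — as `klpls_signedStep_of_expansion` with the extra engine input `Im Σ_b z′_(p,b) = 0` for all
`p` (true for the slice pair weights: `ν ↦ −ν` conjugation symmetry).  Output per pair class: `w : TorusSite 2 L → ℝ` with `Σ|w| ≤ bhi`,
`Σ(|w| − w) ≤ E Qm`, `-E Qm ≤ Σ w`, a two-sided inverse `N` of `1 + diag (w : ℂ)·𝒞_{n−1}(Qm)`, and the `B`-bound on the ball. -/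
theorem klpls_signedStepReal_of_expansion {G : GeoConsts} {β U μ : ℝ} {K₀ : TrigPolyC4v} {n : ℕ} (a₀ : F) {m : ℝ}
    (E : TorusSite 2 L → ℝ) (B : TorusSite 2 L → TorusSite 2 L → TorusSite 2 L → ℝ)
    (hm : 0 ≤ m) (hC : ∀ Qm s t, ‖klPairArray L M β U μ K₀ (n - 1) Qm s t‖ ≤ m) (hsmall : G.bhi * m ≤ 1 / 3)
    (hexp : ∀ Qm : TorusSite 2 L, IsPairClassAt L Qm n →
      ∃ (K : Matrix (TorusSite 2 L × F) (TorusSite 2 L × F) ℂ) (z' : TorusSite 2 L × F → ℂ)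
        (TK : Matrix (TorusSite 2 L × F) (TorusSite 2 L × F) ℂ) (m' : ℝ),
        0 ≤ m' ∧ (∀ x y, ‖K x y‖ ≤ m') ∧ m' * ∑ x, ‖z' x‖ ≤ 1 / 3 ∧ ∑ x, ‖z' x‖ ≤ G.bhi ∧
        (∑ p, ‖∑ b, z' (p, b)‖) - (∑ p, ∑ b, z' (p, b)).re ≤ E Qm ∧ (∀ p, (∑ b, z' (p, b)).im = 0) ∧
        HasSum (fun j : ℕ => K * (-(Matrix.diagonal z' * K)) ^ j) TK ∧
        ∀ k ∈ klBall L μ K₀, ∀ k' ∈ klBall L μ K₀,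
          ‖klPairAmplitude L M β U μ K₀ n Qm k k' - TK (k, a₀) (k', a₀)‖ +
            (‖K (k, a₀) (k', a₀) - klPairArray L M β U μ K₀ (n - 1) Qm k k'‖ +
              3 / 2 * m * ∑ b, ‖K (k, a₀) b - klPairArray L M β U μ K₀ (n - 1) Qm k b.1‖ * ‖z' b‖ +
              3 / 2 * m' * ∑ a, ‖z' a‖ * ‖K a (k', a₀) - klPairArray L M β U μ K₀ (n - 1) Qm a.1 k'‖ +
              9 / 4 * m' * m * ∑ a, ∑ b, ‖z' a‖ * ‖K a b - klPairArray L M β U μ K₀ (n - 1) Qm a.1 b.1‖ * ‖z' b‖) ≤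
          B Qm k k') :
    ∀ Qm : TorusSite 2 L, IsPairClassAt L Qm n →
      ∃ w : TorusSite 2 L → ℝ, (∑ p, |w p| ≤ G.bhi) ∧ (∑ p, (|w p| - w p) ≤ E Qm) ∧ (-E Qm ≤ ∑ p, w p) ∧
        ∃ N : Matrix (TorusSite 2 L) (TorusSite 2 L) ℂ,
          (1 + Matrix.diagonal (fun p => (w p : ℂ)) * klPairArray L M β U μ K₀ (n - 1) Qm) * N = 1 ∧
          N * (1 + Matrix.diagonal (fun p => (w p : ℂ)) * klPairArray L M β U μ K₀ (n - 1) Qm) = 1 ∧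
          ∀ k ∈ klBall L μ K₀, ∀ k' ∈ klBall L μ K₀,
            ‖klPairAmplitude L M β U μ K₀ n Qm k k' - (klPairArray L M β U μ K₀ (n - 1) Qm * N) k k'‖ ≤ B Qm k k' := by
  intro Qm hQm
  obtain ⟨K, z', TK, m', hm', hK, hzK, hzsum, hmass, hreal, hTK, hacc⟩ := hexp Qm hQm
  have hzC : m * ∑ x, ‖z' x‖ ≤ 1 / 3 :=
    calc m * ∑ x, ‖z' x‖ ≤ m * G.bhi := mul_le_mul_of_nonneg_left hzsum hm
      _ = G.bhi * m := mul_comm _ _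
      _ ≤ 1 / 3 := hsmall
  obtain ⟨w, -, hb, hE, hnet, N, hN1, hN2, -, hbd⟩ :=
    klpls_signedStepReal (klPairArray L M β U μ K₀ (n - 1) Qm) K z' hm hm' (hC Qm) hK hzC hzK hzsum hmass hreal TK hTK
  refine ⟨w, hb, hE, hnet, N, hN1, hN2, fun k hk k' hk' => ?_⟩
  have h1 := hacc k hk k' hk'
  have h2 := hbd (k, a₀) (k', a₀)
  have h3 := norm_nonneg (klPairAmplitude L M β U μ K₀ n Qm k k' - TK (k, a₀) (k', a₀))
  calc ‖klPairAmplitude L M β U μ K₀ n Qm k k' - (klPairArray L M β U μ K₀ (n - 1) Qm * N) k k'‖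
      = ‖(klPairAmplitude L M β U μ K₀ n Qm k k' - TK (k, a₀) (k', a₀)) +
          (TK (k, a₀) (k', a₀) - (klPairArray L M β U μ K₀ (n - 1) Qm * N) k k')‖ := by rw [sub_add_sub_cancel]
    _ ≤ ‖klPairAmplitude L M β U μ K₀ n Qm k k' - TK (k, a₀) (k', a₀)‖ +
          ‖TK (k, a₀) (k', a₀) - (klPairArray L M β U μ K₀ (n - 1) Qm * N) k k'‖ := norm_add_le _ _
    _ ≤ B Qm k k' := by linarith

/-- **Package form, V7 budget verbatim.**  `klpls_signedStep_of_expansion` with the entry bound taken from the history's split slot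
`PairArrayAtV2 … (n−1)` (`m = 2|U| + D·U²`, `D = P.C_W + klLegKappa·Q.CR·P.Klam³`, `klpli_pairArray_entry_le`), the smallness
`bhi·(2|U| + D·U²) ≤ 1/3` (`klEng_pair_smallness` for the engine package), and the budget
`B Qm k k′ := drivePBar G P U (n−1) + eremBar G P Q U β L (n−1) + thermalBar G P U β n + legDressBarQ G P Q U n (legSliceCountT … ![k′, Qm−k′, Qm−k, k])`. -/
theorem klpls_signedStep_of_expansion_V7budget {G : GeoConsts} {P : SplitConsts} {Q : EngConsts} {β U μ : ℝ} {K₀ : TrigPolyC4v} {n : ℕ}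
    (a₀ : F) (E : TorusSite 2 L → ℝ)
    (hsplit : PairArrayAtV2 L M P Q β U μ K₀ (n - 1)) (hD : 0 ≤ P.C_W + klLegKappa * Q.CR * P.Klam ^ 3)
    (hsmall : G.bhi * (2 * |U| + (P.C_W + klLegKappa * Q.CR * P.Klam ^ 3) * U ^ 2) ≤ 1 / 3)
    (hexp : ∀ Qm : TorusSite 2 L, IsPairClassAt L Qm n →
      ∃ (K : Matrix (TorusSite 2 L × F) (TorusSite 2 L × F) ℂ) (z' : TorusSite 2 L × F → ℂ)
        (TK : Matrix (TorusSite 2 L × F) (TorusSite 2 L × F) ℂ) (m' : ℝ),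
        0 ≤ m' ∧ (∀ x y, ‖K x y‖ ≤ m') ∧ m' * ∑ x, ‖z' x‖ ≤ 1 / 3 ∧ ∑ x, ‖z' x‖ ≤ G.bhi ∧
        (∑ p, ‖∑ b, z' (p, b)‖) - (∑ p, ∑ b, z' (p, b)).re ≤ E Qm ∧
        HasSum (fun j : ℕ => K * (-(Matrix.diagonal z' * K)) ^ j) TK ∧
        ∀ k ∈ klBall L μ K₀, ∀ k' ∈ klBall L μ K₀,
          ‖klPairAmplitude L M β U μ K₀ n Qm k k' - TK (k, a₀) (k', a₀)‖ +
            (‖K (k, a₀) (k', a₀) - klPairArray L M β U μ K₀ (n - 1) Qm k k'‖ +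
              3 / 2 * (2 * |U| + (P.C_W + klLegKappa * Q.CR * P.Klam ^ 3) * U ^ 2) *
                ∑ b, ‖K (k, a₀) b - klPairArray L M β U μ K₀ (n - 1) Qm k b.1‖ * ‖z' b‖ +
              3 / 2 * m' * ∑ a, ‖z' a‖ * ‖K a (k', a₀) - klPairArray L M β U μ K₀ (n - 1) Qm a.1 k'‖ +
              9 / 4 * m' * (2 * |U| + (P.C_W + klLegKappa * Q.CR * P.Klam ^ 3) * U ^ 2) *
                ∑ a, ∑ b, ‖z' a‖ * ‖K a b - klPairArray L M β U μ K₀ (n - 1) Qm a.1 b.1‖ * ‖z' b‖) ≤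
          drivePBar G P U (n - 1) + eremBar G P Q U β L (n - 1) + thermalBar G P U β n +
            legDressBarQ G P Q U n (legSliceCountT L β μ K₀ n ![k', Qm - k', Qm - k, k])) :
    ∀ Qm : TorusSite 2 L, IsPairClassAt L Qm n →
      ∃ w : TorusSite 2 L → ℂ, (∑ p, ‖w p‖ ≤ G.bhi) ∧ ((∑ p, ‖w p‖) - (∑ p, w p).re ≤ E Qm) ∧ (-E Qm ≤ (∑ p, w p).re) ∧
        ∃ N : Matrix (TorusSite 2 L) (TorusSite 2 L) ℂ,
          (1 + Matrix.diagonal w * klPairArray L M β U μ K₀ (n - 1) Qm) * N = 1 ∧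
          N * (1 + Matrix.diagonal w * klPairArray L M β U μ K₀ (n - 1) Qm) = 1 ∧
          ∀ k ∈ klBall L μ K₀, ∀ k' ∈ klBall L μ K₀,
            ‖klPairAmplitude L M β U μ K₀ n Qm k k' - (klPairArray L M β U μ K₀ (n - 1) Qm * N) k k'‖ ≤
              drivePBar G P U (n - 1) + eremBar G P Q U β L (n - 1) + thermalBar G P U β n +
                legDressBarQ G P Q U n (legSliceCountT L β μ K₀ n ![k', Qm - k', Qm - k, k]) := by
  have hm : 0 ≤ 2 * |U| + (P.C_W + klLegKappa * Q.CR * P.Klam ^ 3) * U ^ 2 := by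
    have : 0 ≤ (P.C_W + klLegKappa * Q.CR * P.Klam ^ 3) * U ^ 2 := mul_nonneg hD (sq_nonneg U)
    have : 0 ≤ |U| := abs_nonneg U
    linarith
  exact klpls_signedStep_of_expansion L M a₀ E
    (fun Qm k k' => drivePBar G P U (n - 1) + eremBar G P Q U β L (n - 1) + thermalBar G P U β n +
      legDressBarQ G P Q U n (legSliceCountT L β μ K₀ n ![k', Qm - k', Qm - k, k]))
    hm (fun Qm s t => klpli_pairArray_entry_le L M hsplit hD Qm s t) hsmall hexp

end Model

end Summit.HubbardSuperconductivity.HubbardSuperconductivity.Theorems.KLRegimeSplit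

end
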